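import Literature.NumberTheory.EllipticCurves.GaloisAction
import Literature.NumberTheory.EllipticCurves.Isogeny
import HarnessLib

/-!
# Zywina 2015: the mod-`ℓ` image of a CM elliptic curve over `ℚ` is never all of `GL₂(𝔽_ℓ)` (`ℓ` odd)

Topic `Literature/NumberTheory/EllipticCurves`. Grounds
`Summit.BirchSwinnertonDyer.BirchSwinnertonDyer.Theses.LeadingTerm.TamePinch`
(item stmt-BirchSwinnertonDyer-15532): that item asks, for EVERY elliptic curve over `ℚ`, for an
"admissible" prime `p ≥ 5` with `W.HasSurjectiveModNGaloisRep p`; for the thirteen CM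
`j`-invariants no such prime exists, by the fact below (the route's own "why it might fail" records
"CM curves have no admissible p"). Refuters and planners take `(h : zywina2015_cm_modEll_not_surjective)`.

One named fact (statement only, D-0014), phrased with the library's predicates
`WeierstrassCurve.HasCM` (geometric CM, `Isogeny.lean`) and
`WeierstrassCurve.HasSurjectiveModNGaloisRep` (`GaloisAction.lean`):

* `zywina2015_cm_modEll_not_surjective` — for every elliptic curve `E/ℚ` with (geometric) complex
  multiplication and every ODD prime `ℓ`, the mod-`ℓ` representation
  `ρ̄_{E,ℓ} : Γ_ℚ → Aut(E[ℓ]) ≅ GL₂(𝔽_ℓ)` is not surjective.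
* API (real proof, one line): `.of_five_le` — the `p ≥ 5` form used against `TamePinch`.

## Source (open access, read: arXiv:1508.07660, §1.9 pp. 9–10 and §7 pp. 31–34)

D. Zywina, *On the possible images of the mod ℓ representations associated to elliptic curves
over ℚ*, arXiv:1508.07660 (2015) [Zywina2015]. §1.9 "Complex multiplication":

> **Proposition 1.14.** Let `E` be a CM elliptic curve defined over `ℚ` with `j_E ≠ 0`. The ring
> of endomorphisms of `E_ℚ̄` is an order of conductor `f` in the ring of integers of an imaginary
> quadratic field of discriminant `−D`. Take any odd prime `ℓ`.
> • If `(−D/ℓ) = 1`, then `ρ_{E,ℓ}(Gal_ℚ)` is conjugate in `GL₂(𝔽_ℓ)` to `N_s(ℓ)`.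
> • If `(−D/ℓ) = −1`, then `ρ_{E,ℓ}(Gal_ℚ)` is conjugate in `GL₂(𝔽_ℓ)` to `N_ns(ℓ)`.
> • Suppose that `ℓ` divides `D` and hence `D = ℓ`. [...] `ρ_{E,ℓ}(Gal_ℚ)` is conjugate in
>   `GL₂(𝔽_ℓ)` to `H₁`, to `H₂`, or to `G = {(a b; 0 ±a)}` [subgroups of the Borel].
>
> **Proposition 1.16.** Let `E` be an elliptic curve over `ℚ` with `j_E = 0`. Take any odd prime
> `ℓ`. [`ℓ ≡ 1 (9)`: conjugate to `N_s(ℓ)`; `ℓ ≡ 8 (9)`: to `N_ns(ℓ)`; `ℓ ≡ 4, 7 (9)`: to `N_s(ℓ)`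
> or to an index-3-type subgroup `G ⊂ N_s(ℓ)`; `ℓ ≡ 2, 5 (9)`: to `N_ns(ℓ)` or to a subgroup
> `G ⊂ N_ns(ℓ)`; `ℓ = 3`: to one of the explicit groups `H_{1,1}, G₁, H_{3,1}, H_{3,2}, G₃`.]

Every group in these two lists is a proper subgroup of `GL₂(𝔽_ℓ)` for odd `ℓ`
(`|N_s(ℓ)| = 2(ℓ−1)²`, `|N_ns(ℓ)| = 2(ℓ²−1)`, the Borel-type groups have order `≤ 2ℓ(ℓ−1)`, all
`< |GL₂(𝔽_ℓ)| = ℓ(ℓ−1)²(ℓ+1)` for `ℓ ≥ 3`; for `ℓ = 3` the listed groups of §1.5 are proper as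
well), and every CM elliptic curve over `ℚ` has `j_E ≠ 0` or `j_E = 0`, so the two propositions
together give the fact as stated. (Proof in §7: `ρ_{E,ℓ}(Gal_k) ≅ (R/ℓR)^×` is a Cartan subgroup
for the CM field `k`, Lemma 7.2, whence `ρ_{E,ℓ}(Gal_ℚ)` lies in its normaliser when `ℓ ∤ D`.)
Classical antecedent: Serre 1972, Invent. Math. 15, §4.5 (CM case: image in the normaliser of a
Cartan subgroup for `ℓ` large) [Serre1972]. The prime `ℓ = 2` is genuinely excluded: by
Prop. 1.15 six CM `j`-invariants (and `y² = x³ + d`, `d` not a cube) have `ρ_{E,2}(Gal_ℚ) = GL₂(𝔽₂)`.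

Transcription: "CM elliptic curve defined over `ℚ`" = `W : WeierstrassCurve ℚ`, `[W.IsElliptic]`,
`W.HasCM` (geometric CM — Zywina's "ring of endomorphisms of `E_ℚ̄`"); "odd prime `ℓ`" =
`ℓ.Prime ∧ ℓ ≠ 2`; "`ρ_{E,ℓ}(Gal_ℚ)` is conjugate to [a proper subgroup]" ⟹ (and this is all that
is vendored) `¬ W.HasSurjectiveModNGaloisRep ℓ`, surjectivity of
`galoisRepTorsion W ℓ : Γ_ℚ →* Aut(E[ℓ])` being independent of the choice of basis
`E[ℓ] ≅ (ℤ/ℓℤ)²`. Weaker than print (conjugacy class not recorded); nothing stronger is claimed.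
-/

namespace Literature.NumberTheory.EllipticCurves

open WeierstrassCurve

/-- **Zywina 2015, Propositions 1.14 and 1.16 (corollary: CM curves over `ℚ` never have surjective
mod-`ℓ` image for odd `ℓ`).** Printed (arXiv:1508.07660, §1.9): for a CM elliptic curve `E/ℚ`
with `j_E ≠ 0` and any odd prime `ℓ`, `ρ_{E,ℓ}(Gal_ℚ)` is conjugate in `GL₂(𝔽_ℓ)` to `N_s(ℓ)`,
to `N_ns(ℓ)`, or (when `ℓ = D`) to one of the Borel-type groups `G, H₁, H₂` (Prop. 1.14); for
`j_E = 0` and any odd prime `ℓ` it is conjugate to `N_s(ℓ)`, `N_ns(ℓ)`, an explicit subgroup of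
one of these, or (for `ℓ = 3`) to one of `H_{1,1}, G₁, H_{3,1}, H_{3,2}, G₃` (Prop. 1.16). All of
these are proper subgroups of `GL₂(𝔽_ℓ)`. Vendored in the weaker basis-free form: for every
elliptic `W/ℚ` with geometric CM and every prime `ℓ ≠ 2`, `ρ̄_{E,ℓ} : Γ_ℚ → Aut(E[ℓ])` is not
surjective. Named fact (D-0014), not proved here (CM theory: `ρ_{E,ℓ}(Gal_k) = (R/ℓR)^×`, §7).
Grounds `Summit.BirchSwinnertonDyer.BirchSwinnertonDyer.Theses.LeadingTerm.TamePinch`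
(stmt-BirchSwinnertonDyer-15532), whose `∀ W` ranges over CM curves too.
[cite: Zywina2015, Prop. 1.14 and Prop. 1.16 (§1.9, arXiv pp. 9–10)] -/
def zywina2015_cm_modEll_not_surjective : Prop :=
  ∀ (W : WeierstrassCurve ℚ) [W.IsElliptic], W.HasCM →
    ∀ ℓ : ℕ, ℓ.Prime → ℓ ≠ 2 → ¬ W.HasSurjectiveModNGaloisRep ℓ

/-! ### Consequences (real proofs, taking the fact as a hypothesis) -/

/-- **The `p ≥ 5` form.** From the fact: a CM elliptic curve over `ℚ` has no prime `p ≥ 5` with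
surjective mod-`p` Galois representation — in particular no "admissible" prime in the sense of
route `BirchSwinnertonDyer/LeadingTerm` (good ordinary `p ≥ 5` with `ρ̄_{E,p}` onto).
[cite: Zywina2015, Prop. 1.14 and Prop. 1.16] -/
theorem zywina2015_cm_modEll_not_surjective.of_five_le
    (h : zywina2015_cm_modEll_not_surjective) (W : WeierstrassCurve ℚ) [W.IsElliptic]
    (hCM : W.HasCM) {p : ℕ} (hp : p.Prime) (h5 : 5 ≤ p) :
    ¬ W.HasSurjectiveModNGaloisRep p :=
  h W hCM p hp (by omega)

/-- **No admissible prime for CM curves** (the shape consumed against `TamePinch`): under the fact,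
there is no prime `p` with `5 ≤ p` and `W.HasSurjectiveModNGaloisRep p` when `W` has CM.
[cite: Zywina2015, Prop. 1.14 and Prop. 1.16] -/
theorem zywina2015_cm_modEll_not_surjective.not_exists_admissible
    (h : zywina2015_cm_modEll_not_surjective) (W : WeierstrassCurve ℚ) [W.IsElliptic]
    (hCM : W.HasCM) :
    ¬ ∃ p : ℕ, p.Prime ∧ 5 ≤ p ∧ W.HasSurjectiveModNGaloisRep p := by
  rintro ⟨p, hp, h5, hs⟩
  exact h.of_five_le W hCM hp h5 hs

end Literature.NumberTheory.EllipticCurves
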